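import Literature.Analysis.FluidPDE.NavierStokesReynolds
import Literature.Analysis.FluidPDE.Antidivergence
import HarnessLib

/-!
# Discharge of `Torus.exists_smooth_antidivergence` (Cheskidov–Luo 2022, §7.2 Def. 7.2)

`Literature/Analysis/FluidPDE/NavierStokesReynolds` records as a named fact
`Torus.exists_smooth_antidivergence` the existence, in dimension `#d ≥ 2`, for every vector field
`f` jointly smooth on `[0, T] × T^d` with zero spatial mean at each time, of a symmetric
trace-free `2`-tensor field `R`, jointly smooth on `[0, T] × T^d`, with `div R(t) = f(t)` — the
tensor-valued antidivergence `ℛ` of De Lellis–Székelyhidi recalled in Cheskidov–Luo 2022, §7.2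
(App. B), Def. 7.2, applied slice-wise in time. This file PROVES it
(`Torus.exists_smooth_antidivergence_holds`) with the explicit operator
`Torus.antidivergence` of `Literature/Analysis/FluidPDE/Antidivergence`:

* `R t := ℛ(f t)` is symmetric (`Torus.antidivergence_symm`), trace free
  (`Torus.antidivergence_trace`) and has `div R(t) = f(t) - ∫ f(t) = f(t)`
  (`Torus.tensorDivergence_antidivergence` and the zero-mean hypothesis);
* joint smoothness on `[0, T] × T^d`: for `T > 0` this is
  `Torus.IsSmoothSpaceTimeOn.antidivergence` (the inverse Laplacian is a mollification by an
  integrable kernel, and slice-wise mollification preserves joint smoothness up to the endpoints,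
  `TorusSpaceTimeKernel`); for `T = 0` the time set is `{0}` and `R` agrees there with the
  time-independent smooth field `ℛ(f 0)`; for `T < 0` the time set is empty.

## References

* A. Cheskidov, X. Luo, *Sharp nonuniqueness for the Navier–Stokes equations*, Invent. Math. 229
  (2022) 987–1054 = arXiv:2009.06596, §7.2 Def. 7.2; §2.6 (use on `[0, T]`). [`CheskidovLuo2022`]
-/

noncomputable section

open MeasureTheory Set Filter Topology Function
open scoped ContDiff

namespace Literature.Analysis.FluidPDE

namespace Torus

open FunctionSpaces FunctionSpaces.Torus

variable {d : Type*} [Fintype d] [DecidableEq d]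

/-- **Cheskidov–Luo 2022, §7.2 Def. 7.2 — the named fact `Torus.exists_smooth_antidivergence`
holds**: in dimension `#d ≥ 2`, every time-dependent vector field `f` jointly smooth on
`[0, T] × T^d` with zero spatial mean at each `t ∈ [0, T]` is the divergence of a symmetric,
trace-free `2`-tensor field jointly smooth on `[0, T] × T^d`, namely `R(t) = ℛ(f(t))` with the
De Lellis–Székelyhidi antidivergence `Torus.antidivergence` (`div ℛv = v - ⨍v`, and `⨍ f(t) = 0`).
[cite: CheskidovLuo2022, §7.2 Def. 7.2] -/
theorem exists_smooth_antidivergence_holds : exists_smooth_antidivergence (d := d) := by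
  intro hd T f hf hmean
  refine ⟨fun t => antidivergence (f t), ?_, ?_, ?_, ?_⟩
  · -- joint smoothness on `[0, T] × T^d`
    rcases lt_trichotomy 0 T with hT | hT | hT
    · exact IsSmoothSpaceTimeOn.antidivergence (convex_Icc 0 T)
        (by rw [interior_Icc]; exact nonempty_Ioo.2 hT) hf
    · subst hT
      have h0 : IsSmooth (f 0) := hf.isSmooth_slice (left_mem_Icc.2 le_rfl)
      have hc := isSmoothSpaceTimeOn_const (isSmooth_antidivergence h0) (Icc (0 : ℝ) 0)
      refine ContDiffOn.congr hc fun z hz => ?_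
      obtain ⟨t, y⟩ := z
      have ht : t = 0 := le_antisymm (mem_prod.1 hz).1.2 (mem_prod.1 hz).1.1
      subst ht
      rfl
    · intro z hz
      exact absurd (mem_prod.1 hz).1 (by rw [Icc_eq_empty_of_lt hT]; exact notMem_empty _)
  · intro t ht x i j
    exact antidivergence_symm (hf.isSmooth_slice ht) x i j
  · intro t ht x
    exact antidivergence_trace hd (hf.isSmooth_slice ht) x
  · intro t ht x
    rw [tensorDivergence_antidivergence hd (hf.isSmooth_slice ht) x,
      show ∫ y, f t y = 0 from hmean t ht, sub_zero]

end Torus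

end Literature.Analysis.FluidPDE
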